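import Literature.MathematicalPhysics.QuantumFieldTheory.Balaban1983to89.B11Prop3Model
import Literature.MathematicalPhysics.QuantumFieldTheory.Balaban1983to89.B11Ineq189LocalLeaf

/-!
# `Balaban1983to89.B11Ineq189LeafDModel` — T. Bałaban, *The variational problem and background fields in renormalization group method for
# lattice gauge theories*, Commun. Math. Phys. **102** (1985) 277–309 [Balaban1985Variational], p. 308, the author-omitted second
# differentiation behind (189): THE LOCATED UNPRINTED INTERMEDIATE δ𝔇 = (δ²/δA′²)D(A′) AT NORM LEVEL, SCHEME LEVEL — for the Sect. C map
# `D = B11Prop3Model.Dfix Ct hop C₂` of ANY quadratic-analytic `C` and bounded linear `H` under the printed hypotheses of Proposition 3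
# (r08's `B11Prop3Model.Inputs` + the printed smallness): `‖(δ²/δA′²)D(A′)[u, v]‖ ≤ 36C₂‖u‖‖v‖` on the inner third of the ball

statement-level skeleton of published theorems with citation tags; proofs where landed; nothing here is a claim about the Yang–Mills mass gap

PDF held: `paper:balaban1985-cmp102-variational-background` (journal page = PDF page + 276); pp. 285–289 [PDF 9–13] (Sect. C: (44)–(55), Prop. 3),
p. 308 [PDF 32] ((185), (189)).  Displays in the transcriptions of record of `B11Prop3Model` / `B11Ineq189`.

CITATION HEADER (lean-in-tree rule 2026-08-18).  WHAT IS REPRODUCED: SKELETON row **B11.Eq189** (GAPS G-B11-G2; census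
`SECOND-DERIVATIVE-189.md` §4 U1: *«The second derivative of D: δ𝔇(A′)[𝔄] := (δ/δA′)𝔇(A′)[𝔄] = (δ²/δA′²)D(A′)[𝔄, ·]. Not displayed anywhere in
B11 or [3]–[6]»*) and row **B11.Prop3** ((55) p. 286 *«|D(A′)| ≤ 4C₂|A′|²_{(−1)}»*; Prop. 3 p. 289 «defined and analytic for A′ satisfying (43)»),
at SCHEME level: r08 g6's `B11Prop3Model` proves, for any `C : 𝒴 → 𝒳` with `‖C(Y)‖ ≤ C₂‖Y‖²`, `C ∈ C¹` on `‖Y‖ < 2c₄` ((44)) and `‖C′(Y)‖ ≤ C₃‖Y‖`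
((72)) and any linear `H` with `‖HX‖ ≤ B₀‖X‖` ((46)) — the structure `Inputs C H C₂ C₃ B₀ c₄` — under «18C₂B₀dc₁(½)ε₃ ≤ 1, 2ε₃ ≤ c₄» that
`D = Dfix C H C₂` obeys (55) (`Dfix_spec`) and is Fréchet-differentiable on `‖A′‖ < ε₃` with the norm-level (73) (`norm_fderiv_Dfix_le`).  THIS
FILE differentiates that D once more by the two-variable Cauchy estimate (`B11Ineq189LocalLeaf.norm_d2_le_of_quad`, (185) applied twice); the
CONCRETE instance (Bałaban's `C_j` on the `ℤᵈ` carrier) is the sibling `B11Ineq189LeafD`.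

WHAT IS CERTIFIED (kernel, sorry-free; standard axioms; theorems only), for complex Banach spaces `𝒴`, `𝒳`, `hin : Inputs Ct hop C₂ C₃ B₀ c₄`,
`0 ≤ C₂, C₃, B₀`, `0 < ε₃`, `18C₂B₀ε₃ ≤ 1`, `2ε₃ ≤ c₄`:
* `differentiableOn_Dfix` — `Dfix Ct hop C₂` is complex-differentiable on the ball `‖A′‖ < ε₃`;
* `quad_Dfix` — (55) there: `‖D(A′)‖ ≤ 4C₂‖A′‖²`;
* **`norm_d2_Dfix`** / **`norm_fderiv_fderiv_Dfix`** / `opNorm_fderiv_fderiv_Dfix` — `‖A′‖ < ε₃/3 ⟹ ‖(δ²/δA′²)D(A′)[u, v]‖ ≤ 36C₂‖u‖‖v‖`,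
  `‖D²D(A′)‖ ≤ 36C₂`: δ𝔇 EXISTS and is BOUNDED at norm level on the inner third of the ball, for every instance of the scheme;
* `norm_d1_Dfix` — `2‖A′‖ < ε₃ ⟹ ‖𝔇(A′) v‖ ≤ 16C₂‖A′‖‖v‖` (p. 291's «power lower by 1»; compare the norm-level (73) `≤ 4C₃ε₃`).

HONEST SCOPE.  Norm level only (no decay — the joint exponential majorant (U1′) is the census's assembly `B11Ineq189.d2D_hasMaj₂`); scheme level
(the objects are r08's abstract `Ct`, `hop`); (189) stays the located leaf (G-B11-G2).  Seat pub-ymgap-dag-n07-b (HUMAN RULING D-0062, node N07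
[B11]).  Imports `B11Prop3Model`, `B11Ineq189LocalLeaf`; no definition, no new named fact.
-/

noncomputable section

open scoped Topology
open Metric Set Filter

namespace Literature.MathematicalPhysics.QuantumFieldTheory.Balaban1983to89.B11Ineq189LeafDModel

open Literature.MathematicalPhysics.QuantumFieldTheory.Balaban1983to89
open B13Contraction113 B11Prop3Model B11Ineq189LocalLeaf

variable {𝒴 𝒳 : Type*} [NormedAddCommGroup 𝒴] [NormedSpace ℂ 𝒴] [NormedAddCommGroup 𝒳] [NormedSpace ℂ 𝒳]
  [CompleteSpace 𝒴] [CompleteSpace 𝒳] {Ct : 𝒴 → 𝒳} {hop : 𝒳 →ₗ[ℂ] 𝒴} {C₂ C₃ B₀ c₄ ε₃ : ℝ}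

/-! ## §1 The scheme-level D on the ball of Proposition 3 -/

/-- **`D = Dfix C H C₂` is complex-differentiable on `‖A′‖ < ε₃`** (`B11Prop3Model.norm_fderiv_Dfix_le`, first conjunct, at every point).
[cite: Balaban1985Variational, Prop. 3 p.289, (47)–(49) p.285] -/
theorem differentiableOn_Dfix (hin : Inputs Ct hop C₂ C₃ B₀ c₄) (hC₂ : 0 ≤ C₂) (hC₃ : 0 ≤ C₃) (hB₀ : 0 ≤ B₀)
    (hε₃ : 0 < ε₃) (h18 : 18 * C₂ * B₀ * ε₃ ≤ 1) (h2 : 2 * ε₃ ≤ c₄) :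
    DifferentiableOn ℂ (Dfix Ct hop C₂) (ball (0 : 𝒴) ε₃) := fun A' hA' => by
  rw [mem_ball_zero_iff] at hA'
  exact (norm_fderiv_Dfix_le hin hC₂ hC₃ hB₀ hε₃ h18 h2 hA').1.differentiableAt.differentiableWithinAt

omit [CompleteSpace 𝒴] in
/-- **(55) on the ball**: `‖D(A′)‖ ≤ 4C₂‖A′‖²` for `‖A′‖ < ε₃` (`B11Prop3Model.Dfix_spec` with the smallness arithmetic `smallness`).
[cite: Balaban1985Variational, (55) p.286] -/
theorem quad_Dfix (hin : Inputs Ct hop C₂ C₃ B₀ c₄) (hC₂ : 0 ≤ C₂) (hB₀ : 0 ≤ B₀)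
    (hε₃ : 0 < ε₃) (h18 : 18 * C₂ * B₀ * ε₃ ≤ 1) (h2 : 2 * ε₃ ≤ c₄) :
    ∀ A' : 𝒴, ‖A'‖ < ε₃ → ‖Dfix Ct hop C₂ A'‖ ≤ (4 * C₂) * ‖A'‖ ^ 2 := by
  intro A' hA'
  have hc₄ : 0 < c₄ := by linarith
  obtain ⟨hq, -, hRC, -⟩ := smallness hC₂ hB₀ hε₃.le le_rfl le_rfl hc₄ (by simpa using h18) h2
  have h := (Dfix_spec (Ct := Ct) (hop := hop) hin.quadAnalytic hC₂ hB₀ hin.norm_H hq hRC hA').1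
  simpa [mul_assoc] using h

/-! ## §2 δ𝔇 = (δ²/δA′²)D at norm level, scheme level -/

/-- **δ𝔇 AT NORM LEVEL, SCHEME LEVEL**: for `‖A′‖ < ε₃/3`, `‖∂_u∂_v D(A′)‖ ≤ 36C₂‖u‖‖v‖` — the two-variable Cauchy estimate
`B11Ineq189LocalLeaf.norm_d2_le_of_quad` fed with §1. [cite: Balaban1985Variational, (189) p.308, (55) p.286, (185) p.308] -/
theorem norm_d2_Dfix (hin : Inputs Ct hop C₂ C₃ B₀ c₄) (hC₂ : 0 ≤ C₂) (hC₃ : 0 ≤ C₃) (hB₀ : 0 ≤ B₀)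
    (hε₃ : 0 < ε₃) (h18 : 18 * C₂ * B₀ * ε₃ ≤ 1) (h2 : 2 * ε₃ ≤ c₄) {X : 𝒴} (hX : ‖X‖ < ε₃ / 3) (u v : 𝒴) :
    ‖fderiv ℂ (fun Y => fderiv ℂ (Dfix Ct hop C₂) Y v) X u‖ ≤ 9 * (4 * C₂) * ‖u‖ * ‖v‖ :=
  norm_d2_le_of_quad (differentiableOn_Dfix hin hC₂ hC₃ hB₀ hε₃ h18 h2) (by positivity)
    (quad_Dfix hin hC₂ hB₀ hε₃ h18 h2) hX u v

/-- The same for the second Fréchet derivative `D²D(A′) u v = (δ²/δA′²)D(A′)[u, v]`. [cite: Balaban1985Variational, (189) p.308, (55) p.286] -/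
theorem norm_fderiv_fderiv_Dfix (hin : Inputs Ct hop C₂ C₃ B₀ c₄) (hC₂ : 0 ≤ C₂) (hC₃ : 0 ≤ C₃) (hB₀ : 0 ≤ B₀)
    (hε₃ : 0 < ε₃) (h18 : 18 * C₂ * B₀ * ε₃ ≤ 1) (h2 : 2 * ε₃ ≤ c₄) {X : 𝒴} (hX : ‖X‖ < ε₃ / 3) (u v : 𝒴) :
    ‖fderiv ℂ (fderiv ℂ (Dfix Ct hop C₂)) X u v‖ ≤ 9 * (4 * C₂) * ‖u‖ * ‖v‖ :=
  norm_fderiv_fderiv_quad_le (differentiableOn_Dfix hin hC₂ hC₃ hB₀ hε₃ h18 h2) (by positivity)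
    (quad_Dfix hin hC₂ hB₀ hε₃ h18 h2) hX u v

/-- **Operator norm**: `‖D²D(A′)‖ ≤ 36C₂` on the inner third of the ball. [cite: Balaban1985Variational, (189) p.308, (55) p.286] -/
theorem opNorm_fderiv_fderiv_Dfix (hin : Inputs Ct hop C₂ C₃ B₀ c₄) (hC₂ : 0 ≤ C₂) (hC₃ : 0 ≤ C₃) (hB₀ : 0 ≤ B₀)
    (hε₃ : 0 < ε₃) (h18 : 18 * C₂ * B₀ * ε₃ ≤ 1) (h2 : 2 * ε₃ ≤ c₄) {X : 𝒴} (hX : ‖X‖ < ε₃ / 3) :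
    ‖fderiv ℂ (fderiv ℂ (Dfix Ct hop C₂)) X‖ ≤ 9 * (4 * C₂) :=
  opNorm_fderiv_fderiv_quad_le (differentiableOn_Dfix hin hC₂ hC₃ hB₀ hε₃ h18 h2) (by positivity)
    (quad_Dfix hin hC₂ hB₀ hε₃ h18 h2) hX

/-! ## §3 The first derivative near the origin -/

/-- **«The power of |A| lower by 1» for the scheme-level D**: `2‖A′‖ < ε₃ ⟹ ‖𝔇(A′) v‖ ≤ 16C₂‖A′‖‖v‖`.
[cite: Balaban1985Variational, p.291, (55) p.286, (185)–(186) p.308] -/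
theorem norm_d1_Dfix (hin : Inputs Ct hop C₂ C₃ B₀ c₄) (hC₂ : 0 ≤ C₂) (hC₃ : 0 ≤ C₃) (hB₀ : 0 ≤ B₀)
    (hε₃ : 0 < ε₃) (h18 : 18 * C₂ * B₀ * ε₃ ≤ 1) (h2 : 2 * ε₃ ≤ c₄) {X : 𝒴} (hX : 2 * ‖X‖ < ε₃) (v : 𝒴) :
    ‖fderiv ℂ (Dfix Ct hop C₂) X v‖ ≤ 4 * (4 * C₂) * ‖X‖ * ‖v‖ :=
  norm_d1_le_of_quad (differentiableOn_Dfix hin hC₂ hC₃ hB₀ hε₃ h18 h2) (by positivity)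
    (quad_Dfix hin hC₂ hB₀ hε₃ h18 h2) hX v

end Literature.MathematicalPhysics.QuantumFieldTheory.Balaban1983to89.B11Ineq189LeafDModel

end
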